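import Summits.CriticalPhenomena.Ising3DConformalLimit.Theses.ModularBoosts
import Summits.CriticalPhenomena.Ising3DConformalLimit.Theorems.MoebiusLimitExists.Negative.FreePermutations
import HarnessLib

/-!
# Route ModularBoosts, item (B₃): axis permutations pass to pointwise scaling limits
(item stmt-CriticalPhenomena-5433, support decl `IsingLimitAxisPermutation` of
`Summits/CriticalPhenomena/Ising3DConformalLimit/Theses/ModularBoosts.lean`)

Every normalised pointwise scaling limit `S` of the critical correlators `criticalCorr 3` on `ℤ³`
(normalised: `S n z = 0` off `NonCoincident`) is invariant under the coordinate permutations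
`P_σ = LinearIsometryEquiv.piLpCongrLeft 2 ℝ ℝ σ` of `ℝ³`, for all `n` and ALL configurations.

Proof. On non-coincident `x` this is the tree theorem
`MoebiusLimitExistsNegative.limit_coordPerm`: the lattice approximation commutes exactly with a
coordinate permutation (`[P_σ p / δ] = g_σ [p / δ]`), the critical plus state is invariant under the
hyperoctahedral group of `ℤ³` (Friedli–Velenik 2017, Exercise 3.14; tree `plusCorr_map_signedPerm`),
so the rescaled correlators agree for every mesh `δ` and the two limits coincide by uniqueness of
limits along `𝓝[>] 0`. Off `NonCoincident` both sides vanish by the normalisation hypothesis, since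
`P_σ` is injective (`map_mem_nonCoincident_iff`). The renormalisation-positivity hypothesis is not
needed.

References: S. Friedli, Y. Velenik, *Statistical Mechanics of Lattice Systems* (CUP 2017),
Exercise 3.14; J. Glimm, A. Jaffe, *Quantum Physics* (1987), §4.2. No definitions are introduced.
-/

noncomputable section

namespace Summit.CriticalPhenomena.Ising3DConformalLimit.Theorems

open Literature.Probability.LatticeModels
open Summit.CriticalPhenomena.Ising3DConformalLimit.MoebiusLimitExistsNegative

/-- **(B₃) passes to the limit** (item stmt-CriticalPhenomena-5433): every normalised pointwise
scaling limit of `criticalCorr 3` is invariant under all coordinate permutations of `ℝ³`, for every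
`n` and every configuration. On `NonCoincident` this is `limit_coordPerm` (exact commutation of
`latticeApprox` with the permutation + hyperoctahedral invariance of the critical state,
Friedli–Velenik 2017, Exercise 3.14); off `NonCoincident` both sides are `0`.
[cite: FriedliVelenik2017, Exercise 3.14, p. 115] -/
theorem isingLimitAxisPermutation_proof :
    Summit.CriticalPhenomena.Ising3DConformalLimit.Theses.ModularBoosts.IsingLimitAxisPermutation := by
  unfold Theses.ModularBoosts.IsingLimitAxisPermutation
  intro ρ S _hρ hlim hnorm σ n x
  by_cases hx : x ∈ NonCoincident 3 n
  · exact limit_coordPerm hlim σ hx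
  · have hx' : (fun i => LinearIsometryEquiv.piLpCongrLeft 2 ℝ ℝ σ (x i)) ∉ NonCoincident 3 n :=
      fun h => hx ((map_mem_nonCoincident_iff _ x).1 h)
    rw [hnorm n _ hx', hnorm n x hx]

end Summit.CriticalPhenomena.Ising3DConformalLimit.Theorems

end
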